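import Literature.AnabelianGeometry.AbsoluteAnabelian.MonoidKummerMaps
import Literature.AnabelianGeometry.AbsoluteAnabelian.UnitKummerModel
import Literature.AnabelianGeometry.AbsoluteAnabelian.MonoidKummerMapsUnitPairProofs
import Literature.AnabelianGeometry.AbsoluteAnabelian.AbsTopIII.EquivariantUnitExponents
import Literature.AnabelianGeometry.AbsoluteAnabelian.AbsTopIII.CyclotomeAutomorphisms
import HarnessLib

/-!
# [AbsTopIII] Prop 3.3 (ii) `TCG` / [IUTchII] Rmk 1.11.1 (i)(b): the `TCG` surjectivity clauses
# reduce to the existence of ONE lift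

Proof-only companion (theorems only, no new definitions) of `MonoidKummerMaps.lean` (seat
abc-iut-L4-t2; S. Mochizuki, *Topics in Absolute Anabelian Geometry III*, Prop. 3.3 (ii) p. 74 with
the author's Comments (2019) item (5); *Inter-universal Teichmüller Theory II*, Rmk. 1.11.1 (i)(b)
p. 50; kurims manuscripts, lit keys `paper:url-5493eb38cbb7`, `paper:url-5036b4059555`).

For MLF-Galois `TCG`-pairs (`M ≅ 𝒪_k̄^×`) the typed surjectivity clauses — the `TCG` conjunct of
`UnitPairIsoFibresOfType H` and `TCGPairIsoLiftsOfMonoAnalytic` — ask that EVERY pair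
(`f : Π ⥲ Π*`, `u : μ_Ẑ(M) ⥲ μ_Ẑ(M*)`) be realised by an isomorphism of pairs.  Here:

* `GaloisMonoidPair.Iso.tcg_exists_realising_of_model` / `…tcg_exists_realising` — given ONE lift
  `e₀` over `f`, every `u` is realised by a lift over `f`: twist `e₀` by the `Gal(k̄/k)`-equivariant
  automorphism `x ↦ x^a` of `𝒪_k̄^×` (`EquivariantUnitExponents.lean`, abc-iut-L6-d1) whose exponent
  system `a ∈ Ẑ^×` is read off from the cyclotome automorphism `u₀⁻¹ ∘ u`
  (`CyclotomeAutomorphisms.lean`: `Aut(μ_Ẑ) = Ẑ^×`);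
* `unitPairIsoFibresOfType_tcg_of_exists_lift`, `tcgPairIsoLiftsOfMonoAnalytic_of_exists_lift` — hence
  both named `TCG` clauses FOLLOW from the pure existence of one lift per admissible `f` (the
  local-class-field-theoretic reconstruction of `𝒪_k̄^×` from `G_k`, [AbsAnab] Prop. 1.2.1 — FACT-level,
  not addressed), exactly as for `TLG` (abc-iut-L6-t21, `MonoidKummerMapsUnitFibresProofs`).

HONEST FRAMING: OUR kernel check of a reduction between statements of refereed papers; nothing here
bears on [IUTchIII] Cor. 3.12.
-/

noncomputable section

namespace Literature.AnabelianGeometry.AbsoluteAnabelian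

open _root_.ValuativeRel

/-! ### The model core -/

/-- **Core (model level).**  For the model data `(k, k̄, Π_k ↠ G_k)` with model `TCG`-pair
`Q₀ = (Π_k ↷ 𝒪_k̄^×)`, a pair `P ≅ Q₀`, ONE isomorphism of pairs `e₀ : P ⥲ Q` and ANY isomorphism of
cyclotomes `u : μ_Ẑ(M_P) ⥲ μ_Ẑ(M_Q)`: some isomorphism of pairs over the same `Π ⥲ Π*` induces `u`.
[cite: MochizukiAbsTopIII2015, Proposition 3.3 (ii) p.74] -/
theorem GaloisMonoidPair.Iso.tcg_exists_realising_of_model (C : MLFClosure.{0})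
    (D : ModelMLFGaloisData C.k C.K) {Q₀ P Q : GaloisMonoidPair.{0}}
    (hQ₀ : D.monoidPair .TCG = some Q₀) (ι : GaloisMonoidPair.Iso Q₀ P)
    (e₀ : GaloisMonoidPair.Iso P Q) (u : cyclotome P.M ≃* cyclotome Q.M) :
    ∃ e : GaloisMonoidPair.Iso P Q, e.isoPi = e₀.isoPi ∧
      ∀ ζ : cyclotome P.M,
        Literature.AnabelianGeometry.EtaleTheta.cyclotome.map (Units.map e.isoM.toMonoidHom) ζ = u ζ := by
  classical
  simp only [ModelMLFGaloisData.monoidPair, Option.some.injEq] at hQ₀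
  subst hQ₀
  letI : MulDistribMulAction D.Pi (unitSubmonoid C.k C.K) :=
    D.submonoidAction (unitSubmonoid C.k C.K) (fun σ _ h => smul_mem_unitSubmonoid σ h)
  have hsmul : ∀ (g : D.Pi) (m : unitSubmonoid C.k C.K),
      ((g • m : unitSubmonoid C.k C.K) : C.K) = D.aug g (m : C.K) := fun g m => rfl
  -- cyclotome equivalences induced by multiplicative equivalences (data inside the proof)
  have cyc : ∀ {X Y : Type} [CommMonoid X] [CommMonoid Y] (φ : X ≃* Y),
      ∃ Φ : cyclotome X ≃* cyclotome Y, ∀ ζ,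
        Φ ζ = EtaleTheta.cyclotome.map (Units.map φ.toMonoidHom) ζ ∧
        Φ.symm (EtaleTheta.cyclotome.map (Units.map φ.toMonoidHom) ζ) = ζ := by
    intro X Y _ _ φ
    refine ⟨{ toFun := EtaleTheta.cyclotome.map (Units.map φ.toMonoidHom)
              invFun := EtaleTheta.cyclotome.map (Units.map φ.symm.toMonoidHom)
              left_inv := fun ζ => ?_, right_inv := fun ζ => ?_, map_mul' := map_mul _ }, fun ζ => ⟨rfl, ?_⟩⟩
    · exact Subtype.ext (funext fun n => Units.ext (by simp))
    · exact Subtype.ext (funext fun n => Units.ext (by simp))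
    · exact Subtype.ext (funext fun n => Units.ext (by simp))
  obtain ⟨cι, hcι⟩ := cyc ι.isoM
  obtain ⟨ce₀, hce₀⟩ := cyc e₀.isoM
  -- the automorphism of `μ_Ẑ(𝒪_k̄^×)` to be realised, and its transport to `Λ(k̄ˣ)`
  set wP : cyclotome P.M ≃* cyclotome P.M := u.trans ce₀.symm with hwP
  set w₀ : cyclotome (unitSubmonoid C.k C.K) ≃* cyclotome (unitSubmonoid C.k C.K) :=
    cι.trans (wP.trans cι.symm) with hw₀
  set E := C.cyclotomeUnitGroupEquiv with hE
  set w : EtaleTheta.cyclotome (C.K)ˣ ≃* EtaleTheta.cyclotome (C.K)ˣ := E.symm.trans (w₀.trans E) with hw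
  -- components of `E` and `E.symm`
  have hEc : ∀ (ξ : cyclotome (unitSubmonoid C.k C.K)) (n : ℕ+),
      (((E ξ : EtaleTheta.cyclotome (C.K)ˣ) : ℕ+ → (C.K)ˣ) n : C.K) =
        (((ξ : ℕ+ → (unitSubmonoid C.k C.K)ˣ) n : unitSubmonoid C.k C.K) : C.K) := fun ξ n => rfl
  have hEsc : ∀ (G : EtaleTheta.cyclotome (C.K)ˣ) (n : ℕ+),
      ((((E.symm G : cyclotome (unitSubmonoid C.k C.K)) : ℕ+ → (unitSubmonoid C.k C.K)ˣ) n :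
        unitSubmonoid C.k C.K) : C.K) = ((G : ℕ+ → (C.K)ˣ) n : C.K) := by
    intro G n
    rw [← hEc (E.symm G) n, MulEquiv.apply_symm_apply]
  -- exponents of `w`, and the equivariant automorphism `β = (·)^a` of `𝒪_k̄^×`
  obtain ⟨a, ha, hcop, hw_formula⟩ := C.cyclotome_mulEquiv_exponents w
  obtain ⟨β, hβσ, hβμ, -⟩ := C.exists_equivariant_unitMulEquiv_of_compatible a ha hcop
  -- `β` as an automorphism of the model pair over the identity
  have hβ_smul : ∀ (g : D.Pi) (x : unitSubmonoid C.k C.K), β (g • x) = g • β x := by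
    intro g x
    apply Subtype.ext
    rw [hsmul]
    exact hβσ (D.aug g) x (g • x) (hsmul g x)
  -- transport to `P`: `jM = ι ∘ β ∘ ι⁻¹`
  let jM : P.M ≃* P.M := ι.isoM.symm.trans (β.trans ι.isoM)
  have hjM : ∀ x, jM x = ι.isoM (β (ι.isoM.symm x)) := fun x => rfl
  have hjM_smul : ∀ (g : P.Pi) (x : P.M), jM (g • x) = g • jM x := by
    intro g x
    rw [hjM, hjM, GaloisMonoidPair.Iso.symm_smul_comm, hβ_smul, ι.smul_comm,
      ContinuousMulEquiv.apply_symm_apply]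
  -- the twisted lift
  let e : GaloisMonoidPair.Iso P Q :=
    { isoPi := e₀.isoPi, isoM := jM.trans e₀.isoM
      smul_comm := fun g x => by
        change e₀.isoM (jM (g • x)) = e₀.isoPi g • e₀.isoM (jM x)
        rw [hjM_smul, e₀.smul_comm] }
  refine ⟨e, rfl, fun ζ => ?_⟩
  -- (⋆₀): `Λ(β) = w₀` on `μ_Ẑ(𝒪_k̄^×)`
  have key₀ : ∀ ξ : cyclotome (unitSubmonoid C.k C.K),
      EtaleTheta.cyclotome.map (Units.map β.toMonoidHom) ξ = w₀ ξ := by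
    intro ξ
    apply Subtype.ext
    funext n
    apply Units.ext
    apply Subtype.ext
    -- left: `β (ξ n)`; right: `(w₀ ξ) n = (E.symm (w (E ξ))) n`
    have hR : w₀ ξ = E.symm (w (E ξ)) := by
      rw [hw]
      simp [MulEquiv.trans_apply, MulEquiv.symm_apply_apply]
    rw [hR, hEsc, hw_formula (E ξ) n, Units.val_pow_eq_pow_val, hEc]
    -- left side is `β` applied to a root of unity
    have hroot : ((((ξ : ℕ+ → (unitSubmonoid C.k C.K)ˣ) n : unitSubmonoid C.k C.K)) : C.K) ^ (n : ℕ) = 1 := by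
      have h := EtaleTheta.cyclotome.pow_eq_one ξ n
      have h' := congrArg (fun v : (unitSubmonoid C.k C.K)ˣ => ((v : unitSubmonoid C.k C.K) : C.K)) h
      simpa [Units.val_pow_eq_pow_val] using h'
    exact hβμ _ n n.pos hroot
  -- (⋆): `Λ(jM) = wP` on `μ_Ẑ(M_P)`
  have key : EtaleTheta.cyclotome.map (Units.map jM.toMonoidHom) ζ = wP ζ := by
    set ξ := cι.symm ζ with hξ
    have hζ : ζ = cι ξ := by rw [hξ, MulEquiv.apply_symm_apply]
    -- `Λ(jM) (Λ(ι) ξ) = Λ(ι) (Λ(β) ξ)`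
    have h1 : EtaleTheta.cyclotome.map (Units.map jM.toMonoidHom) (cι ξ) =
        cι (EtaleTheta.cyclotome.map (Units.map β.toMonoidHom) ξ) := by
      rw [(hcι ξ).1, (hcι _).1]
      apply Subtype.ext; funext n; apply Units.ext
      simp [hjM]
    have h2 : wP (cι ξ) = cι (w₀ ξ) := by
      rw [hw₀]
      simp [MulEquiv.trans_apply]
    rw [hζ, h1, key₀, h2]
  -- conclusion: `Λ(e) ζ = Λ(e₀) (Λ(jM) ζ) = ce₀ (wP ζ) = u ζ`
  have h3 : EtaleTheta.cyclotome.map (Units.map e.isoM.toMonoidHom) ζ =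
      EtaleTheta.cyclotome.map (Units.map e₀.isoM.toMonoidHom)
        (EtaleTheta.cyclotome.map (Units.map jM.toMonoidHom) ζ) := by
    apply Subtype.ext; funext n; apply Units.ext; rfl
  rw [h3, key, ← (hce₀ _).1, hwP]
  simp [MulEquiv.trans_apply]

/-- **Prop 3.3 (ii) `TCG`, realisation of cyclotome isomorphisms — PROVED given one lift.**  For
MLF-Galois `TCG`-pairs and ONE isomorphism of pairs `e₀ : (Π ↷ M) ⥲ (Π* ↷ M*)`, EVERY isomorphism of
cyclotomes `u : μ_Ẑ(M) ⥲ μ_Ẑ(M*)` is induced by an isomorphism of pairs with the same Galois component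
(the fibre over `Π ⥲ Π*` is a `Ẑ^×`-torsor, `Aut(μ_Ẑ) = Ẑ^×`).  (Only the hypothesis on `P` is used.)
[cite: MochizukiAbsTopIII2015, Proposition 3.3 (ii) p.74] -/
theorem GaloisMonoidPair.Iso.tcg_exists_realising {P Q : GaloisMonoidPair.{0}}
    (hP : IsMLFGaloisMonoidPair .TCG P) (e₀ : GaloisMonoidPair.Iso P Q)
    (u : cyclotome P.M ≃* cyclotome Q.M) :
    ∃ e : GaloisMonoidPair.Iso P Q, e.isoPi = e₀.isoPi ∧
      ∀ ζ : cyclotome P.M,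
        Literature.AnabelianGeometry.EtaleTheta.cyclotome.map (Units.map e.isoM.toMonoidHom) ζ = u ζ := by
  obtain ⟨C, D, Q₀, hQ₀, ⟨ι⟩⟩ := hP.exists_model
  exact GaloisMonoidPair.Iso.tcg_exists_realising_of_model C D hQ₀ ι e₀ u

/-! ### The named `TCG` clauses reduce to the existence of one lift -/

/-- **`UnitPairIsoFibresOfType`, `TCG` clause ⇐ existence of lifts.**  If over every admissible
`f : Π ⥲ Π*` between MLF-Galois `TCG`-pairs satisfying `H` there is SOME isomorphism of pairs, then the
(corrected, [AbsTopIII] Comments (2019) item (5)) `TCG` surjectivity clause of Prop. 3.3 (ii) holds: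
every `(f, u)` is realised. [cite: MochizukiAbsTopIII2015, Proposition 3.3 (ii) p.74] -/
theorem unitPairIsoFibresOfType_tcg_of_exists_lift (H : GaloisMonoidPair.{0} → Prop)
    (hex : ∀ (P Q : GaloisMonoidPair.{0}), IsMLFGaloisMonoidPair .TCG P → IsMLFGaloisMonoidPair .TCG Q →
      H P → H Q → ∀ f : P.Pi ≃ₜ* Q.Pi, P.actionKer.map f.toMulEquiv.toMonoidHom = Q.actionKer →
        ∃ e : GaloisMonoidPair.Iso P Q, e.isoPi = f) :
    ∀ (P Q : GaloisMonoidPair.{0}), IsMLFGaloisMonoidPair .TCG P → IsMLFGaloisMonoidPair .TCG Q →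
      H P → H Q →
      ∀ f : P.Pi ≃ₜ* Q.Pi, P.actionKer.map f.toMulEquiv.toMonoidHom = Q.actionKer →
      ∀ u : cyclotome P.M ≃* cyclotome Q.M,
        ∃ e : GaloisMonoidPair.Iso P Q, e.isoPi = f ∧
          ∀ ζ : cyclotome P.M,
            Literature.AnabelianGeometry.EtaleTheta.cyclotome.map (Units.map e.isoM.toMonoidHom) ζ = u ζ := by
  intro P Q hP hQ hHP hHQ f hf u
  obtain ⟨e₀, he₀⟩ := hex P Q hP hQ hHP hHQ f hf
  obtain ⟨e, he, hu⟩ := GaloisMonoidPair.Iso.tcg_exists_realising hP e₀ u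
  exact ⟨e, he.trans he₀, hu⟩

/-- **`UnitPairIsoFibresOfType` from lifting statements.**  The corrected Prop. 3.3 (ii) surjectivity
schema holds as soon as (TCG) every admissible `f` between `TCG`-pairs satisfying `H` lifts, and (TLG)
the `TLG` two-lift clause holds (for the latter see abc-iut-L6-t21's `MonoidKummerMapsUnitFibresProofs`,
which reduces it likewise to one lift per `f`). [cite: MochizukiAbsTopIII2015, Proposition 3.3 (ii) p.74] -/
theorem unitPairIsoFibresOfType_of_lifts (H : GaloisMonoidPair.{0} → Prop)
    (hexTCG : ∀ (P Q : GaloisMonoidPair.{0}), IsMLFGaloisMonoidPair .TCG P → IsMLFGaloisMonoidPair .TCG Q →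
      H P → H Q → ∀ f : P.Pi ≃ₜ* Q.Pi, P.actionKer.map f.toMulEquiv.toMonoidHom = Q.actionKer →
        ∃ e : GaloisMonoidPair.Iso P Q, e.isoPi = f)
    (hTLG : ∀ (P Q : GaloisMonoidPair.{0}), IsMLFGaloisMonoidPair .TLG P → IsMLFGaloisMonoidPair .TLG Q →
      H P → H Q →
      ∀ f : P.Pi ≃ₜ* Q.Pi, P.actionKer.map f.toMulEquiv.toMonoidHom = Q.actionKer →
        ∃ e₁ e₂ : GaloisMonoidPair.Iso P Q, e₁.isoPi = f ∧ e₂.isoPi = f ∧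
        e₁.isoM ≠ e₂.isoM ∧ ∀ e : GaloisMonoidPair.Iso P Q, e.isoPi = f →
          (e.isoM = e₁.isoM ∨ e.isoM = e₂.isoM)) :
    UnitPairIsoFibresOfType H :=
  ⟨unitPairIsoFibresOfType_tcg_of_exists_lift H hexTCG, hTLG⟩

/-- **`TCGPairIsoLiftsOfMonoAnalytic` ⇐ existence of lifts** ([IUTchII] Rmk. 1.11.1 (i)(b): for the
mono-analytic pair `G ↷ 𝒪^×(G)`, "surjectively … onto … Aut(G), with kernel … the natural action of
`Ẑ^×`").  The kernel half is supplied here (the `Ẑ^×`-torsor theorems); the surjectivity half is the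
hypothesis. [cite: Mochizuki2012, II Rmk 1.11.1 (i) p.50] -/
theorem tcgPairIsoLiftsOfMonoAnalytic_of_exists_lift
    (hex : ∀ (P Q : GaloisMonoidPair.{0}), IsMLFGaloisMonoidPair .TCG P → IsMLFGaloisMonoidPair .TCG Q →
      IsOfMonoAnalyticTypeMonoid .TCG P → IsOfMonoAnalyticTypeMonoid .TCG Q →
      ∀ f : P.Pi ≃ₜ* Q.Pi, ∃ e : GaloisMonoidPair.Iso P Q, e.isoPi = f) :
    TCGPairIsoLiftsOfMonoAnalytic := by
  intro P Q hP hQ hPm hQm f u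
  obtain ⟨e₀, he₀⟩ := hex P Q hP hQ hPm hQm f
  obtain ⟨e, he, hu⟩ := GaloisMonoidPair.Iso.tcg_exists_realising hP e₀ u
  exact ⟨e, he.trans he₀, hu⟩

end Literature.AnabelianGeometry.AbsoluteAnabelian

end
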